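import Literature.MathematicalPhysics.QuantumFieldTheory.Balaban1983to89.Beta.RemainderDecay190
import Literature.MathematicalPhysics.QuantumFieldTheory.Balaban1983to89.B11Ineq190Actual

/-!
# [Balaban1985Variational] Sect. G (182)–(190) p. 308 ⟶ the (190)-socket of the (D4) remainder chain: the field
`Data190.h190` JOINED to the per-torus Sect. G letters with ONE constant for all tori (`Beta.RemainderDecay190SectG`)

HONEST FRAMING (cell rule).  Bookkeeping for the k-uniform remainder chain of row (D4) (`RemainderConst` ⇐ ONE
`ChainTFac190` instance, `Beta.RemainderDecay190`); discharges NOTHING of `BetaPertH`; NOT the continuum limit, NOT Clay.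
It supplies the ONE per-field lemma the (190)-socket `Data190` (NODE D of the (D4) skeleton) did not have: every other
estimate-bearing field of the leaf lists already has a hypothesis-to-field lemma in the tree (`Gaps.D4NodeEConvergence`
for `hconv`, `B13Lemma3TorusSocket` / `RemainderStepAdapterHolo` for `h238`, `Spine.NE5.StepObjectFromActivities` for the
seam), while `h190 : ∀ n i, Ineq190 (bBn n) (boutn n i) (dHn n) q.Cst q.δ15` asks for ONE constant `q.Cst` over ALL tori
n and ALL local sizes i — and the tree's (189) ⇒ (190) (`B11SectG.ineq190_of_189`, `B11Ineq190Actual.ineq190_sectG`)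
delivers, lattice by lattice, the constant `const190 bB.κ bN.κ b3.κ …` in the CUTTING CONSTANTS OF THAT LATTICE, and
for the entries n = 2, 3, 4 only `∃ C` (`ineq190_strong_of_189`); the sibling join for b03's WINDOW family
`B12Decay510SectG.decay510_window_sectG` (lit-balaban r20) takes EQUAL cutting constants and the one size `bN`.  The join
here: (§1) the strong entries with the O(1) written out; (§2) monotonicity of that O(1) in κ_B, κ_N, κ₃ ((1 − q)⁻¹ included);
(§3) `h190_of_sectG` — the field's type VERBATIM from per-torus letters with common O(1) letters, cutting constants
bounded by κ̄'s, one row sum (2.61), and any `Cst` above the written-out O(1) at the bounds, any rate reading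
`δ15 ≤ δ₀`; (§4) the same for the ACTUAL Fréchet derivative of the (179) chart (`B11Eq183Differentiation.chartH179`),
where (182)/(184)/(188) are theorems; (§5) the certificate that these letters + the (4.4)-dictionary letters inhabit
`Data190 d M N Wn q` (`Nonempty`, no `def`); (§6) the same certificate for the actual derivative (§4's data).

CITATION HEADER.  [15] = T. Bałaban, *The variational problem and background fields in renormalization group method
for lattice gauge theories*, Commun. Math. Phys. **102**, 277–309 (1985) [Balaban1985Variational], Sect. G (182)–(190)
pp. 307–308, Prop. 9 p. 309 (held `paper:balaban1985-cmp102-variational-background`, PDF page = journal page − 276;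
the quotations are those certified in `B11SectG` / `B11Ineq190Actual`, re-read for this module in the text layer
p0031–p0032); [3] = *Propagators and renormalization transformations … II*, CMP **96** (1984) [Balaban1984PropagatorsII],
Lemma 2.1 (2.61) p. 234; [I] = CMP **109** (1987) [Balaban1987RG1], (4.4) p. 281, p. 282.  Unit `b2b-balaban-beta-an4`
gen 89 (BINDER row D4 OWNER), 2026-08-23.  Imports `Beta.RemainderDecay190` + `B11Ineq190Actual`; modifies nothing.

WHAT IS NOT CLAIMED.  (189) is NOT proved (hypothesis `h189`, author-omitted in print — cell GAPS G-B11-G2); the kernel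
letters of G̃, Δ⁽²⁾H₀, H₀, H, 𝔇 are hypotheses of the printed shapes; the words *"and finally Proposition 2 and (181)"*
(G-B11-G2a) are not typed; the uniformity of [15]'s O(1) letters over the tori is DISPLAYED as the hypothesis shape
(common letters), not derived; NO operator of Bałaban's step is constructed (NODE O; instance count of row (D4) 0∕1,
unchanged).  No `def`, no named fact, no `sorry`, standard axioms.
-/

namespace Literature.MathematicalPhysics.QuantumFieldTheory.Balaban1983to89.Beta.RemainderDecay190SectG

open Literature.MathematicalPhysics.QuantumFieldTheory.Balaban1983to89 B11SectG B6RandomWalk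

/-! ## 1. (189) ⇒ (190) into an arbitrary local size, the O(1) EXPLICIT -/

section Explicit

variable {g : B6.Geometry} {FB FA F3 : Type} [AddCommGroup FB] [Module ℝ FB] [AddCommGroup FA] [Module ℝ FA]
  [AddCommGroup F3] [Module ℝ F3]

/-- **(189) ⇒ (190), ALL ENTRIES, WITH THE O(1) WRITTEN OUT** — `B11SectG.ineq190_strong_of_189` (p. 308: *"This
inequality [(189)], the formula (188) and Lemma 2.1 … yield (190)"*, entries n = 2, 3, 4: majorants of G̃, H₀, H INTO a
second local size `bN₂`) with its existential constant NAMED: δ𝓗 = (δ/δB)𝓗 has the block majorant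
`[κ₃B′_G(c_Δ + κ_Nθ_W(A₀ + C_𝔄)c)c + A′₀] + κ_B A′_H κ_N θ_𝔇 (C_𝔄 + A₀) c² · e^{−⅛δ₀d(y,y′)}` from the B-size into `bN₂`,
`C_𝔄 = B11SectG.constA0 …` the (188)-Neumann constant of 𝔄₀ (with `bN₂ := bN` these are the entries n = 0, 1).  Inputs =
the located leaves of print as in `B11SectG` ((189) `h189` author-omitted, cell GAPS G-B11-G2; kernel letters of G̃, Δ⁽²⁾H₀,
H₀, H, 𝔇; carriers (182)/(184)/(188); Lemma 2.1 [3]; (2.54); q < 1 of (187)).  Naming the constant is what makes the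
bound UNIFORMISABLE over a family of lattices (§2–§3). [cite: Balaban1985Variational, (182)-(190) pp.307-308] -/
theorem ineq190_strong_explicit_of_189 {bB : BlockNorm g FB} {bN bN₂ : BlockNorm g FA} {b3 : BlockNorm g F3}
    {Gt : F3 →ₗ[ℝ] FA} {W : FA →ₗ[ℝ] F3} {D2H0 : FB →ₗ[ℝ] F3} {H0 H A0 dH : FB →ₗ[ℝ] FA} {Dfr : FA →ₗ[ℝ] FB}
    {δ₀ BG BG₂ θW cΔ A₀ A₀₂ AH₂ θD M₀ c : ℝ}
    (htri : Triangle254 g) (hd : ∀ a b : g.Site, 0 ≤ g.dist a b) (hδ₀ : 0 ≤ δ₀) (hrow : RowSum g (δ₀ / 8) c)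
    (hc : 0 ≤ c) (hBG : 0 ≤ BG) (hBG₂ : 0 ≤ BG₂) (hθW : 0 ≤ θW) (hcΔ : 0 ≤ cΔ) (hA₀ : 0 ≤ A₀) (hA₀₂ : 0 ≤ A₀₂)
    (hAH₂ : 0 ≤ AH₂) (hθD : 0 ≤ θD) (hM₀ : 0 ≤ M₀)
    (hG : HasMaj b3 bN Gt (fun y y' => BG * Real.exp (-(δ₀ * g.dist y y'))))
    (hG₂ : HasMaj b3 bN₂ Gt (fun y y' => BG₂ * Real.exp (-(δ₀ * g.dist y y'))))
    (h189 : Ineq189 bN b3 W θW δ₀)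
    (hD2H0 : HasMaj bB b3 D2H0 (fun y y' => cΔ * Real.exp (-(δ₀ * g.dist y y'))))
    (hH0 : HasMaj bB bN H0 (fun y y' => A₀ * Real.exp (-(δ₀ * g.dist y y'))))
    (hH0₂ : HasMaj bB bN₂ H0 (fun y y' => A₀₂ * Real.exp (-(δ₀ * g.dist y y'))))
    (hH₂ : HasMaj bB bN₂ H (fun y y' => AH₂ * Real.exp (-(δ₀ / 2 * g.dist y y'))))
    (hDfr : HasMaj bN bB Dfr (fun y y' => θD * Real.exp (-(δ₀ / 2 * g.dist y y'))))
    (h184 : Eq184 A0 H0 Gt W D2H0) (h188 : Bound188 bB bN A0 M₀) (h182 : Eq182 dH A0 H0 H Dfr)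
    (hq : qG b3.κ bN.κ BG θW c < 1) :
    Ineq190 bB bN₂ dH
      ((b3.κ * BG₂ * (cΔ + bN.κ * θW * (A₀ + constA0 b3.κ bN.κ BG θW cΔ A₀ c) * c) * c + A₀₂) +
        bB.κ * AH₂ * (bN.κ * θD * (constA0 b3.κ bN.κ BG θW cΔ A₀ c + A₀) * c) * c) δ₀ := by
  have hA0 := A0_majorant_of_189 htri hd hδ₀ hrow hc hBG hθW hcΔ hA₀ hM₀ hG h189 hD2H0 hH0 h184 h188 hq
  have hCA : 0 ≤ constA0 b3.κ bN.κ BG θW cΔ A₀ c :=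
    constA0_nonneg b3.κ_nonneg bN.κ_nonneg hBG hθW hcΔ hA₀ hc hq
  have hA0₂ := A0_strong_of_184 htri hd hδ₀ hrow hc hBG₂ hθW hcΔ hA₀ hCA hG₂ h189 hD2H0 hH0 hA0 h184
  exact dH_majorant_of_182 (bout := bN₂) htri hd hδ₀ hrow hCA hA₀ hA₀₂ hAH₂ hθD hA0 hH0 hA0₂ hH0₂ hH₂ hDfr h182

end Explicit

/-! ## 2. Monotonicity of the O(1) in the cutting constants (private helpers for the uniformisation of §3) -/

section Mono

/-- The Neumann ratio q = κ_N·(κ₃B_Gθ_Wc)·c of (187)–(188) is monotone in the cutting constants (letters ≥ 0). [folklore] -/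
private theorem qG_mono {κ₃ κ₃' κN κN' BG θW c : ℝ} (h₃ : κ₃ ≤ κ₃') (hN : κN ≤ κN') (hκ₃ : 0 ≤ κ₃) (hκN : 0 ≤ κN)
    (hBG : 0 ≤ BG) (hθW : 0 ≤ θW) (hc : 0 ≤ c) : qG κ₃ κN BG θW c ≤ qG κ₃' κN' BG θW c := by
  have hκN' : 0 ≤ κN' := hκN.trans hN
  unfold qG thetaK
  gcongr

/-- The right-hand-side constant of (184), `constS`, is monotone in κ₃, κ_N (letters ≥ 0). [folklore] -/
private theorem constS_mono {κ₃ κ₃' κN κN' BG θW cΔ A₀ c : ℝ} (h₃ : κ₃ ≤ κ₃') (hN : κN ≤ κN') (hκ₃ : 0 ≤ κ₃)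
    (hκN : 0 ≤ κN) (hBG : 0 ≤ BG) (hθW : 0 ≤ θW) (hcΔ : 0 ≤ cΔ) (hA₀ : 0 ≤ A₀) (hc : 0 ≤ c) :
    constS κ₃ κN BG θW cΔ A₀ c ≤ constS κ₃' κN' BG θW cΔ A₀ c := by
  have hκN' : 0 ≤ κN' := hκN.trans hN
  unfold constS thetaK
  gcongr

/-- The (188)-Neumann constant `constA0 = constS·(1 − q)⁻¹` is monotone in κ₃, κ_N while the larger ratio is < 1. [folklore] -/
private theorem constA0_mono {κ₃ κ₃' κN κN' BG θW cΔ A₀ c : ℝ} (h₃ : κ₃ ≤ κ₃') (hN : κN ≤ κN') (hκ₃ : 0 ≤ κ₃)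
    (hκN : 0 ≤ κN) (hBG : 0 ≤ BG) (hθW : 0 ≤ θW) (hcΔ : 0 ≤ cΔ) (hA₀ : 0 ≤ A₀) (hc : 0 ≤ c)
    (hq' : qG κ₃' κN' BG θW c < 1) :
    constA0 κ₃ κN BG θW cΔ A₀ c ≤ constA0 κ₃' κN' BG θW cΔ A₀ c := by
  have hκ₃' : 0 ≤ κ₃' := hκ₃.trans h₃
  have hκN' : 0 ≤ κN' := hκN.trans hN
  have hqq : qG κ₃ κN BG θW c ≤ qG κ₃' κN' BG θW c := qG_mono h₃ hN hκ₃ hκN hBG hθW hc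
  have hS := constS_mono (cΔ := cΔ) (A₀ := A₀) h₃ hN hκ₃ hκN hBG hθW hcΔ hA₀ hc
  have hS' : 0 ≤ constS κ₃' κN' BG θW cΔ A₀ c := constS_nonneg hκ₃' hκN' hBG hθW hcΔ hA₀ hc
  have hinv : (1 - qG κ₃ κN BG θW c)⁻¹ ≤ (1 - qG κ₃' κN' BG θW c)⁻¹ :=
    inv_anti₀ (by linarith) (by linarith)
  unfold constA0
  exact mul_le_mul hS hinv (inv_nonneg.mpr (by linarith)) hS'

/-- The written-out O(1) of (190) (§1) is monotone in the cutting constants κ_B, κ_N, κ₃ while the larger Neumann ratio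
is < 1 — over a FAMILY of block-normed spaces with cutting constants ≤ κ̄_B, κ̄_N, κ̄₃ one constant serves all. [folklore] -/
private theorem const190_explicit_mono {κB κB' κN κN' κ₃ κ₃' BG BG₂ θW cΔ A₀ A₀₂ AH₂ θD c : ℝ} (hB : κB ≤ κB')
    (hN : κN ≤ κN') (h₃ : κ₃ ≤ κ₃') (hκB : 0 ≤ κB) (hκN : 0 ≤ κN) (hκ₃ : 0 ≤ κ₃) (hBG : 0 ≤ BG) (hBG₂ : 0 ≤ BG₂)
    (hθW : 0 ≤ θW) (hcΔ : 0 ≤ cΔ) (hA₀ : 0 ≤ A₀) (hAH₂ : 0 ≤ AH₂) (hθD : 0 ≤ θD) (hc : 0 ≤ c)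
    (hq' : qG κ₃' κN' BG θW c < 1) :
    (κ₃ * BG₂ * (cΔ + κN * θW * (A₀ + constA0 κ₃ κN BG θW cΔ A₀ c) * c) * c + A₀₂) +
        κB * AH₂ * (κN * θD * (constA0 κ₃ κN BG θW cΔ A₀ c + A₀) * c) * c ≤
      (κ₃' * BG₂ * (cΔ + κN' * θW * (A₀ + constA0 κ₃' κN' BG θW cΔ A₀ c) * c) * c + A₀₂) +
        κB' * AH₂ * (κN' * θD * (constA0 κ₃' κN' BG θW cΔ A₀ c + A₀) * c) * c := by
  have hκB' : 0 ≤ κB' := hκB.trans hB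
  have hκN' : 0 ≤ κN' := hκN.trans hN
  have hκ₃' : 0 ≤ κ₃' := hκ₃.trans h₃
  have hqq : qG κ₃ κN BG θW c ≤ qG κ₃' κN' BG θW c := qG_mono h₃ hN hκ₃ hκN hBG hθW hc
  have hCA : 0 ≤ constA0 κ₃ κN BG θW cΔ A₀ c := constA0_nonneg hκ₃ hκN hBG hθW hcΔ hA₀ hc (hqq.trans_lt hq')
  have hCA' : 0 ≤ constA0 κ₃' κN' BG θW cΔ A₀ c := constA0_nonneg hκ₃' hκN' hBG hθW hcΔ hA₀ hc hq'
  have hmono := constA0_mono (cΔ := cΔ) (A₀ := A₀) h₃ hN hκ₃ hκN hBG hθW hcΔ hA₀ hc hq'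
  gcongr

/-- The written-out O(1) of (190) is non-negative (letters ≥ 0, Neumann ratio < 1). [folklore] -/
private theorem const190_explicit_nonneg {κB κN κ₃ BG BG₂ θW cΔ A₀ A₀₂ AH₂ θD c : ℝ} (hκB : 0 ≤ κB) (hκN : 0 ≤ κN)
    (hκ₃ : 0 ≤ κ₃) (hBG : 0 ≤ BG) (hBG₂ : 0 ≤ BG₂) (hθW : 0 ≤ θW) (hcΔ : 0 ≤ cΔ) (hA₀ : 0 ≤ A₀) (hA₀₂ : 0 ≤ A₀₂)
    (hAH₂ : 0 ≤ AH₂) (hθD : 0 ≤ θD) (hc : 0 ≤ c) (hq : qG κ₃ κN BG θW c < 1) :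
    0 ≤ (κ₃ * BG₂ * (cΔ + κN * θW * (A₀ + constA0 κ₃ κN BG θW cΔ A₀ c) * c) * c + A₀₂) +
        κB * AH₂ * (κN * θD * (constA0 κ₃ κN BG θW cΔ A₀ c + A₀) * c) * c := by
  have hCA : 0 ≤ constA0 κ₃ κN BG θW cΔ A₀ c := constA0_nonneg hκ₃ hκN hBG hθW hcΔ hA₀ hc hq
  positivity

end Mono

/-! ## 3. THE FIELD `Data190.h190` FROM THE PER-TORUS SECT. G LETTERS — the join, constant uniform over the tori -/

section Join

variable {I : Type} {gn : ℕ → B6.Geometry} {FB FA F3 : ℕ → Type} [∀ n, AddCommGroup (FB n)] [∀ n, Module ℝ (FB n)]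
  [∀ n, AddCommGroup (FA n)] [∀ n, Module ℝ (FA n)] [∀ n, AddCommGroup (F3 n)] [∀ n, Module ℝ (F3 n)]

/-- **THE (190)-FIELD OF THE (D4) SOCKET, JOINED TO [15] SECT. G ON EVERY TORUS** — literally the type of the field
`Beta.RemainderDecay190.Data190.h190 : ∀ n i, Ineq190 (bBn n) (boutn n i) (dHn n) q.Cst q.δ15`.  On the n-th torus let
Sect. G's data be given in the shape of `B11SectG` — geometry `gn n` with (2.54) and d ≥ 0, B-size `bB n`, N-size `bN n`,
the size `b3 n` of (186)/(189), the consumers' local sizes `bout n i`, the operators G̃, W = ((δ²/δA′²)V)(𝒜₀ + H₀B),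
Δ⁽²⁾H₀, H₀, H, 𝔄₀ = (δ/δB)𝒜₀, 𝔇 and δ𝓗 = (δ/δB)𝓗 (`dH n`) with the carriers (182), (184), (188) and the located letters
(189), G̃, Δ⁽²⁾H₀, H₀, H, 𝔇 — THE SAME O(1) LETTERS AND RATE δ₀ ON EVERY TORUS (the uniformity of [15]'s constants in the
volume DISPLAYED as the hypothesis shape), one row sum (2.61) at a rate σ ≤ ⅛δ₀, cutting constants ≤ κ̄_B, κ̄_N, κ̄₃
with the Neumann ratio of (187) at the bounds < 1.  THEN for every `Cst` above the written-out O(1) at the bounds and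
every rate reading `δ15 ≤ δ₀`: `∀ n i, Ineq190 (bB n) (bout n i) (dH n) Cst δ15` (§1 per torus, §2 to the bounds, rates
only get worse).  No operator of Bałaban's is constructed (they are the parameters); (189) stays the located
author-omitted leaf (cell GAPS G-B11-G2); *"and finally Proposition 2 and (181)"* is not typed (G-B11-G2a).
[cite: Balaban1985Variational, (182)-(190) pp.307-308; Balaban1984PropagatorsII, Lemma 2.1 (2.61) p.234] -/
theorem h190_of_sectG (bB : (n : ℕ) → BlockNorm (gn n) (FB n)) (bN : (n : ℕ) → BlockNorm (gn n) (FA n))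
    (b3 : (n : ℕ) → BlockNorm (gn n) (F3 n)) (bout : (n : ℕ) → I → BlockNorm (gn n) (FA n))
    (Gt : (n : ℕ) → F3 n →ₗ[ℝ] FA n) (W : (n : ℕ) → FA n →ₗ[ℝ] F3 n) (D2H0 : (n : ℕ) → FB n →ₗ[ℝ] F3 n)
    (H0 H A0 dH : (n : ℕ) → FB n →ₗ[ℝ] FA n) (Dfr : (n : ℕ) → FA n →ₗ[ℝ] FB n) (M₀ : ℕ → ℝ)
    {δ₀ σ c BG BG₂ θW cΔ A₀ A₀₂ AH₂ θD κB κN κ₃ Cst δ15 : ℝ}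
    (htri : ∀ n, Triangle254 (gn n)) (hd : ∀ n (a b : (gn n).Site), 0 ≤ (gn n).dist a b) (hδ₀ : 0 ≤ δ₀)
    (hrow : ∀ n, RowSum (gn n) σ c) (hσ : σ ≤ δ₀ / 8)
    (hBG : 0 ≤ BG) (hBG₂ : 0 ≤ BG₂) (hθW : 0 ≤ θW) (hcΔ : 0 ≤ cΔ) (hA₀ : 0 ≤ A₀) (hA₀₂ : 0 ≤ A₀₂)
    (hAH₂ : 0 ≤ AH₂) (hθD : 0 ≤ θD) (hM₀ : ∀ n, 0 ≤ M₀ n)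
    (hκB : ∀ n, (bB n).κ ≤ κB) (hκN : ∀ n, (bN n).κ ≤ κN) (hκ₃ : ∀ n, (b3 n).κ ≤ κ₃)
    (hG : ∀ n, HasMaj (b3 n) (bN n) (Gt n) (fun y y' => BG * Real.exp (-(δ₀ * (gn n).dist y y'))))
    (hG₂ : ∀ n i, HasMaj (b3 n) (bout n i) (Gt n) (fun y y' => BG₂ * Real.exp (-(δ₀ * (gn n).dist y y'))))
    (h189 : ∀ n, Ineq189 (bN n) (b3 n) (W n) θW δ₀)
    (hD2H0 : ∀ n, HasMaj (bB n) (b3 n) (D2H0 n) (fun y y' => cΔ * Real.exp (-(δ₀ * (gn n).dist y y'))))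
    (hH0 : ∀ n, HasMaj (bB n) (bN n) (H0 n) (fun y y' => A₀ * Real.exp (-(δ₀ * (gn n).dist y y'))))
    (hH0₂ : ∀ n i, HasMaj (bB n) (bout n i) (H0 n) (fun y y' => A₀₂ * Real.exp (-(δ₀ * (gn n).dist y y'))))
    (hH₂ : ∀ n i, HasMaj (bB n) (bout n i) (H n) (fun y y' => AH₂ * Real.exp (-(δ₀ / 2 * (gn n).dist y y'))))
    (hDfr : ∀ n, HasMaj (bN n) (bB n) (Dfr n) (fun y y' => θD * Real.exp (-(δ₀ / 2 * (gn n).dist y y'))))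
    (h184 : ∀ n, Eq184 (A0 n) (H0 n) (Gt n) (W n) (D2H0 n)) (h188 : ∀ n, Bound188 (bB n) (bN n) (A0 n) (M₀ n))
    (h182 : ∀ n, Eq182 (dH n) (A0 n) (H0 n) (H n) (Dfr n))
    (hq : qG κ₃ κN BG θW c < 1)
    (hCst : (κ₃ * BG₂ * (cΔ + κN * θW * (A₀ + constA0 κ₃ κN BG θW cΔ A₀ c) * c) * c + A₀₂) +
        κB * AH₂ * (κN * θD * (constA0 κ₃ κN BG θW cΔ A₀ c + A₀) * c) * c ≤ Cst)
    (hδ15 : δ15 ≤ δ₀) :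
    ∀ n i, Ineq190 (bB n) (bout n i) (dH n) Cst δ15 := by
  intro n i
  have hκBn := (bB n).κ_nonneg
  have hκNn := (bN n).κ_nonneg
  have hκ₃n := (b3 n).κ_nonneg
  -- the row sum at the rate ⅛δ₀ at which Sect. G uses Lemma 2.1, and its constant c ≥ 0
  have hrow' : RowSum (gn n) (δ₀ / 8) c := (hrow n).mono (hd n) hσ
  have hc : 0 ≤ c ∨ IsEmpty (gn n).Site := by
    by_cases hne : Nonempty (gn n).Site
    · exact Or.inl ((hrow n).nonneg (Classical.arbitrary _))
    · exact Or.inr (not_nonempty_iff.mp hne)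
  rcases hc with hc | hemp
  · -- the Neumann ratio on the n-th torus is below the ratio at the bounds
    have hqn : qG (b3 n).κ (bN n).κ BG θW c < 1 :=
      (qG_mono (hκ₃ n) (hκN n) hκ₃n hκNn hBG hθW hc).trans_lt hq
    -- §1 on the n-th torus
    have h1 := ineq190_strong_explicit_of_189 (htri n) (hd n) hδ₀ hrow' hc hBG hBG₂ hθW hcΔ hA₀ hA₀₂ hAH₂ hθD (hM₀ n)
      (hG n) (hG₂ n i) (h189 n) (hD2H0 n) (hH0 n) (hH0₂ n i) (hH₂ n i) (hDfr n) (h184 n) (h188 n) (h182 n) hqn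
    -- §2: pass to the bounds κ̄, then to Cst
    have h2 := (const190_explicit_mono (BG₂ := BG₂) (A₀₂ := A₀₂) (AH₂ := AH₂) (θD := θD) (hκB n) (hκN n) (hκ₃ n)
      hκBn hκNn hκ₃n hBG hBG₂ hθW hcΔ hA₀ hAH₂ hθD hc hq).trans hCst
    have h0 : 0 ≤ Cst := (const190_explicit_nonneg (hκBn.trans (hκB n)) (hκNn.trans (hκN n)) (hκ₃n.trans (hκ₃ n))
      hBG hBG₂ hθW hcΔ hA₀ hA₀₂ hAH₂ hθD hc hq).trans hCst
    have h3 : Ineq190 (bB n) (bout n i) (dH n) Cst δ₀ := by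
      unfold Ineq190 at h1 ⊢
      exact h1.mono fun y y' => mul_le_mul_of_nonneg_right h2 (Real.exp_nonneg _)
    -- rates only get worse: ⅛δ15 ≤ ⅛δ₀
    unfold Ineq190 at h3 ⊢
    exact h3.of_rate_le (hd n) h0 (by linarith)
  · -- no blocks: every majorant statement is vacuous
    intro y' μ _ y
    exact (IsEmpty.false y).elim

/-- **The same with δ𝓗 DEFINED by (182)** — `dH n := (𝔄₀ + H₀) − H·𝔇·(𝔄₀ + H₀)` (the carrier `Eq182` then holds by `rfl`):
the shape in which a builder who has 𝔄₀, H₀, H, 𝔇 as terms writes the socket's fields `dHn := …`, `h190 := …` with NO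
operator identity left to supply for (182). [cite: Balaban1985Variational, (182) p.307, (190) p.308] -/
theorem h190_of_sectG_eq182 (bB : (n : ℕ) → BlockNorm (gn n) (FB n)) (bN : (n : ℕ) → BlockNorm (gn n) (FA n))
    (b3 : (n : ℕ) → BlockNorm (gn n) (F3 n)) (bout : (n : ℕ) → I → BlockNorm (gn n) (FA n))
    (Gt : (n : ℕ) → F3 n →ₗ[ℝ] FA n) (W : (n : ℕ) → FA n →ₗ[ℝ] F3 n) (D2H0 : (n : ℕ) → FB n →ₗ[ℝ] F3 n)
    (H0 H A0 : (n : ℕ) → FB n →ₗ[ℝ] FA n) (Dfr : (n : ℕ) → FA n →ₗ[ℝ] FB n) (M₀ : ℕ → ℝ)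
    {δ₀ σ c BG BG₂ θW cΔ A₀ A₀₂ AH₂ θD κB κN κ₃ Cst δ15 : ℝ}
    (htri : ∀ n, Triangle254 (gn n)) (hd : ∀ n (a b : (gn n).Site), 0 ≤ (gn n).dist a b) (hδ₀ : 0 ≤ δ₀)
    (hrow : ∀ n, RowSum (gn n) σ c) (hσ : σ ≤ δ₀ / 8)
    (hBG : 0 ≤ BG) (hBG₂ : 0 ≤ BG₂) (hθW : 0 ≤ θW) (hcΔ : 0 ≤ cΔ) (hA₀ : 0 ≤ A₀) (hA₀₂ : 0 ≤ A₀₂)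
    (hAH₂ : 0 ≤ AH₂) (hθD : 0 ≤ θD) (hM₀ : ∀ n, 0 ≤ M₀ n)
    (hκB : ∀ n, (bB n).κ ≤ κB) (hκN : ∀ n, (bN n).κ ≤ κN) (hκ₃ : ∀ n, (b3 n).κ ≤ κ₃)
    (hG : ∀ n, HasMaj (b3 n) (bN n) (Gt n) (fun y y' => BG * Real.exp (-(δ₀ * (gn n).dist y y'))))
    (hG₂ : ∀ n i, HasMaj (b3 n) (bout n i) (Gt n) (fun y y' => BG₂ * Real.exp (-(δ₀ * (gn n).dist y y'))))
    (h189 : ∀ n, Ineq189 (bN n) (b3 n) (W n) θW δ₀)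
    (hD2H0 : ∀ n, HasMaj (bB n) (b3 n) (D2H0 n) (fun y y' => cΔ * Real.exp (-(δ₀ * (gn n).dist y y'))))
    (hH0 : ∀ n, HasMaj (bB n) (bN n) (H0 n) (fun y y' => A₀ * Real.exp (-(δ₀ * (gn n).dist y y'))))
    (hH0₂ : ∀ n i, HasMaj (bB n) (bout n i) (H0 n) (fun y y' => A₀₂ * Real.exp (-(δ₀ * (gn n).dist y y'))))
    (hH₂ : ∀ n i, HasMaj (bB n) (bout n i) (H n) (fun y y' => AH₂ * Real.exp (-(δ₀ / 2 * (gn n).dist y y'))))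
    (hDfr : ∀ n, HasMaj (bN n) (bB n) (Dfr n) (fun y y' => θD * Real.exp (-(δ₀ / 2 * (gn n).dist y y'))))
    (h184 : ∀ n, Eq184 (A0 n) (H0 n) (Gt n) (W n) (D2H0 n)) (h188 : ∀ n, Bound188 (bB n) (bN n) (A0 n) (M₀ n))
    (hq : qG κ₃ κN BG θW c < 1)
    (hCst : (κ₃ * BG₂ * (cΔ + κN * θW * (A₀ + constA0 κ₃ κN BG θW cΔ A₀ c) * c) * c + A₀₂) +
        κB * AH₂ * (κN * θD * (constA0 κ₃ κN BG θW cΔ A₀ c + A₀) * c) * c ≤ Cst)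
    (hδ15 : δ15 ≤ δ₀) :
    ∀ n i, Ineq190 (bB n) (bout n i) ((A0 n + H0 n) - H n ∘ₗ (Dfr n ∘ₗ (A0 n + H0 n))) Cst δ15 :=
  h190_of_sectG bB bN b3 bout Gt W D2H0 H0 H A0 (fun n => (A0 n + H0 n) - H n ∘ₗ (Dfr n ∘ₗ (A0 n + H0 n))) Dfr M₀
    htri hd hδ₀ hrow hσ hBG hBG₂ hθW hcΔ hA₀ hA₀₂ hAH₂ hθD hM₀ hκB hκN hκ₃ hG hG₂ h189 hD2H0 hH0 hH0₂ hH₂ hDfr h184 h188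
    (fun _ => rfl) hq hCst hδ15

end Join

/-! ## 4. The join FOR THE ACTUAL FRÉCHET DERIVATIVE of the (179) chart — carriers (182)/(184)/(188) are theorems -/

section Actual

open B11Eq174Chart B11Eq183Differentiation B11Ineq190Actual

variable {I : Type} {gn : ℕ → B6.Geometry} {𝒳 𝒴 𝒵 : ℕ → Type} [∀ n, NormedAddCommGroup (𝒳 n)]
  [∀ n, NormedSpace ℂ (𝒳 n)] [∀ n, NormedAddCommGroup (𝒴 n)] [∀ n, NormedSpace ℂ (𝒴 n)]
  [∀ n, NormedAddCommGroup (𝒵 n)] [∀ n, NormedSpace ℂ (𝒵 n)] [∀ n, CompleteSpace (𝒳 n)] [∀ n, CompleteSpace (𝒴 n)]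
  [∀ n, CompleteSpace (𝒵 n)]

/-- **THE (190)-FIELD OF THE (D4) SOCKET FOR THE ACTUAL DERIVATIVE `(δ/δB)𝓗(B)` ON EVERY TORUS.**  On the n-th torus let
Bałaban's data of (179)–(180) be given in the scheme vocabulary of `B11Eq183Differentiation` — complex Banach spaces
`𝒳 n ∋ B`, `𝒴 n` (the space (115)), `𝒵 n`; G̃ (`𝒢 n`), W = (δ/δA′)V (`Wv n`, analytic on `‖Y‖ < a₃`), Δ⁽²⁾ (`D2 n`),
H₀, H, the Sect. C map D (`Dm n`) with derivative 𝔇 at 𝒜₀(B) + H₀B, the contraction regime (117)–(121) (`R n`), a point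
`B n` of the domain of (180) — so that δ𝓗 IS `fderiv ℂ (chartH179 …) (B n)` and (182), (184), (188) are THEOREMS
(`eq182_sectG`, `eq184_sectG`, `bound188_sectG`); block sizes with the size/norm compatibility letters `hN`, `hBloc` and
cutting constants ≤ κ̄_B, κ̄_N, κ̄₃; the located leaves (189) (at A′ = 𝒜₀(B) + H₀B), G̃, Δ⁽²⁾H₀, H₀, H, 𝔇 with O(1)
letters and rate δ₀ COMMON TO ALL TORI; one row sum (2.61) at a rate σ ≤ ⅛δ₀; the Neumann ratio at the bounds < 1.
THEN `∀ n i, Ineq190 (bB n) (bout n i) (δ𝓗_n) Cst δ15` — the field `Data190.h190` with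
`dHn n := (fderiv ℂ (chartH179 …) (B n)).restrictScalars ℝ`.  Hypotheses = the located leaves of print ((189)
author-omitted, G-B11-G2; kernel letters; Lemma 2.1; (2.54); q < 1) and the OBJECTS 𝒢, W, Δ⁽²⁾, H₀, H, D of Bałaban's
step on the torus, parameters here (NODE O; instance count of row (D4) unchanged). [cite: Balaban1985Variational, (179)-(190) pp.306-308, Prop. 9 p.309; Balaban1984PropagatorsII, Lemma 2.1 (2.61) p.234] -/
theorem h190_of_sectG_actual (𝒢 : (n : ℕ) → 𝒵 n →L[ℂ] 𝒴 n) (Wv : (n : ℕ) → 𝒴 n → 𝒵 n)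
    (D2 : (n : ℕ) → 𝒴 n →L[ℂ] 𝒵 n) (H₀ H : (n : ℕ) → 𝒳 n →L[ℂ] 𝒴 n) (Dm : (n : ℕ) → 𝒴 n → 𝒳 n)
    (𝔇 : (n : ℕ) → 𝒴 n →L[ℂ] 𝒳 n) (B₀ θ C₄ a₃ j a ε₄ : ℕ → ℝ) (B : (n : ℕ) → 𝒳 n)
    (R : ∀ n, Regime (𝒢 n) 0 (Wv n) (B₀ n) (θ n) (C₄ n) (a₃ n) (j n) (a n) (ε₄ n))
    (hWa : ∀ n, AnalyticOnNhd ℂ (Wv n) {Y : 𝒴 n | ‖Y‖ < a₃ n})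
    (hJ : ∀ n, ‖D2 n (H₀ n (B n))‖ < j n) (h𝔄 : ∀ n, ‖H₀ n (B n)‖ < a n)
    (hD : ∀ n, HasFDerivAt (Dm n) (𝔇 n) (solA180 (𝒢 n) (Wv n) (D2 n) (H₀ n) (ε₄ n) (B n) + H₀ n (B n)))
    (bB : (n : ℕ) → BlockNorm (gn n) (𝒳 n)) (bN : (n : ℕ) → BlockNorm (gn n) (𝒴 n))
    (b3 : (n : ℕ) → BlockNorm (gn n) (𝒵 n)) (bout : (n : ℕ) → I → BlockNorm (gn n) (𝒴 n))
    (hN : ∀ n (y : (gn n).Site) (v : 𝒴 n), (bN n).loc y v ≤ ‖v‖)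
    (hBloc : ∀ n (y' : (gn n).Site) (μ : 𝒳 n), (bB n).IsLoc y' μ → ‖μ‖ ≤ (bB n).loc y' μ)
    {δ₀ σ c BG BG₂ θW cΔ A₀ A₀₂ AH₂ θD κB κN κ₃ Cst δ15 : ℝ}
    (htri : ∀ n, Triangle254 (gn n)) (hd : ∀ n (a b : (gn n).Site), 0 ≤ (gn n).dist a b) (hδ₀ : 0 ≤ δ₀)
    (hrow : ∀ n, RowSum (gn n) σ c) (hσ : σ ≤ δ₀ / 8)
    (hBG : 0 ≤ BG) (hBG₂ : 0 ≤ BG₂) (hθW : 0 ≤ θW) (hcΔ : 0 ≤ cΔ) (hA₀ : 0 ≤ A₀) (hA₀₂ : 0 ≤ A₀₂)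
    (hAH₂ : 0 ≤ AH₂) (hθD : 0 ≤ θD)
    (hκB : ∀ n, (bB n).κ ≤ κB) (hκN : ∀ n, (bN n).κ ≤ κN) (hκ₃ : ∀ n, (b3 n).κ ≤ κ₃)
    (hG : ∀ n, HasMaj (b3 n) (bN n) ((𝒢 n).restrictScalars ℝ : 𝒵 n →ₗ[ℝ] 𝒴 n)
      (fun y y' => BG * Real.exp (-(δ₀ * (gn n).dist y y'))))
    (hG₂ : ∀ n i, HasMaj (b3 n) (bout n i) ((𝒢 n).restrictScalars ℝ : 𝒵 n →ₗ[ℝ] 𝒴 n)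
      (fun y y' => BG₂ * Real.exp (-(δ₀ * (gn n).dist y y'))))
    (h189 : ∀ n, Ineq189 (bN n) (b3 n)
      ((fderiv ℂ (Wv n) (solA180 (𝒢 n) (Wv n) (D2 n) (H₀ n) (ε₄ n) (B n) + H₀ n (B n))).restrictScalars ℝ :
        𝒴 n →ₗ[ℝ] 𝒵 n) θW δ₀)
    (hD2H0 : ∀ n, HasMaj (bB n) (b3 n) ((D2 n ∘L H₀ n).restrictScalars ℝ : 𝒳 n →ₗ[ℝ] 𝒵 n)
      (fun y y' => cΔ * Real.exp (-(δ₀ * (gn n).dist y y'))))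
    (hH0 : ∀ n, HasMaj (bB n) (bN n) ((H₀ n).restrictScalars ℝ : 𝒳 n →ₗ[ℝ] 𝒴 n)
      (fun y y' => A₀ * Real.exp (-(δ₀ * (gn n).dist y y'))))
    (hH0₂ : ∀ n i, HasMaj (bB n) (bout n i) ((H₀ n).restrictScalars ℝ : 𝒳 n →ₗ[ℝ] 𝒴 n)
      (fun y y' => A₀₂ * Real.exp (-(δ₀ * (gn n).dist y y'))))
    (hH₂ : ∀ n i, HasMaj (bB n) (bout n i) ((H n).restrictScalars ℝ : 𝒳 n →ₗ[ℝ] 𝒴 n)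
      (fun y y' => AH₂ * Real.exp (-(δ₀ / 2 * (gn n).dist y y'))))
    (hDfr : ∀ n, HasMaj (bN n) (bB n) ((𝔇 n).restrictScalars ℝ : 𝒴 n →ₗ[ℝ] 𝒳 n)
      (fun y y' => θD * Real.exp (-(δ₀ / 2 * (gn n).dist y y'))))
    (hq : qG κ₃ κN BG θW c < 1)
    (hCst : (κ₃ * BG₂ * (cΔ + κN * θW * (A₀ + constA0 κ₃ κN BG θW cΔ A₀ c) * c) * c + A₀₂) +
        κB * AH₂ * (κN * θD * (constA0 κ₃ κN BG θW cΔ A₀ c + A₀) * c) * c ≤ Cst)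
    (hδ15 : δ15 ≤ δ₀) :
    ∀ n i, Ineq190 (bB n) (bout n i)
      ((fderiv ℂ (chartH179 (𝒢 n) (Wv n) (D2 n) (H₀ n) (fun Y : 𝒴 n => Y - H n (Dm n Y)) (ε₄ n)) (B n)).restrictScalars ℝ :
        𝒳 n →ₗ[ℝ] 𝒴 n) Cst δ15 :=
  h190_of_sectG bB bN b3 bout (fun n => ((𝒢 n).restrictScalars ℝ : 𝒵 n →ₗ[ℝ] 𝒴 n))
    (fun n => ((fderiv ℂ (Wv n) (solA180 (𝒢 n) (Wv n) (D2 n) (H₀ n) (ε₄ n) (B n) + H₀ n (B n))).restrictScalars ℝ :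
      𝒴 n →ₗ[ℝ] 𝒵 n))
    (fun n => ((D2 n ∘L H₀ n).restrictScalars ℝ : 𝒳 n →ₗ[ℝ] 𝒵 n))
    (fun n => ((H₀ n).restrictScalars ℝ : 𝒳 n →ₗ[ℝ] 𝒴 n)) (fun n => ((H n).restrictScalars ℝ : 𝒳 n →ₗ[ℝ] 𝒴 n))
    (fun n => ((fderiv ℂ (solA180 (𝒢 n) (Wv n) (D2 n) (H₀ n) (ε₄ n)) (B n)).restrictScalars ℝ : 𝒳 n →ₗ[ℝ] 𝒴 n))
    (fun n => ((fderiv ℂ (chartH179 (𝒢 n) (Wv n) (D2 n) (H₀ n) (fun Y : 𝒴 n => Y - H n (Dm n Y)) (ε₄ n))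
      (B n)).restrictScalars ℝ : 𝒳 n →ₗ[ℝ] 𝒴 n))
    (fun n => ((𝔇 n).restrictScalars ℝ : 𝒴 n →ₗ[ℝ] 𝒳 n))
    (fun n => (1 - ‖𝒢 n ∘L fderiv ℂ (Wv n) (solA180 (𝒢 n) (Wv n) (D2 n) (H₀ n) (ε₄ n) (B n) + H₀ n (B n))‖)⁻¹ *
      ‖𝒢 n ∘L (D2 n ∘L H₀ n) -
        (𝒢 n ∘L fderiv ℂ (Wv n) (solA180 (𝒢 n) (Wv n) (D2 n) (H₀ n) (ε₄ n) (B n) + H₀ n (B n))) ∘L H₀ n‖)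
    htri hd hδ₀ hrow hσ hBG hBG₂ hθW hcΔ hA₀ hA₀₂ hAH₂ hθD (fun n => M0_sectG_nonneg (R n) (hWa n) (hJ n) (h𝔄 n))
    hκB hκN hκ₃ hG hG₂ h189 hD2H0 hH0 hH0₂ hH₂ hDfr (fun n => eq184_sectG (R n) (hWa n) (hJ n) (h𝔄 n))
    (fun n => bound188_sectG (R n) (hWa n) (hJ n) (h𝔄 n) (hN n) (hBloc n))
    (fun n => eq182_sectG (R n) (hWa n) (hJ n) (h𝔄 n) (H n) (hD n)) hq hCst hδ15

end Actual

/-! ## 5. JOIN CERTIFICATE: the Sect. G letters + the (4.4)-dictionary letters INHABIT the (190)-socket `Data190` -/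

section Certificate

open Literature.MathematicalPhysics.QuantumFieldTheory.Balaban1983to89.B12Decay510FromB11 (NormDominated UnitFieldsLocalised)
open Literature.MathematicalPhysics.QuantumFieldTheory.Balaban1983to89.TreeLengthTorus (TPt TDom tsys)
open Literature.MathematicalPhysics.QuantumFieldTheory.Balaban1983to89.B12Decay510Torus (geomT)
open Literature.MathematicalPhysics.QuantumFieldTheory.Balaban1983to89.Beta.RemainderDecay190 (Data190 Consts190)
variable {d M : ℕ} [NeZero M] {N : ℕ → ℕ} [∀ n, NeZero (N n)] {Wn : ℕ → Type} [∀ n, NormedAddCommGroup (Wn n)]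
  {q : Consts190} {I : Type} {gn : ℕ → B6.Geometry} {FB FA F3 : ℕ → Type} [∀ n, AddCommGroup (FB n)] [∀ n, Module ℝ (FB n)]
  [∀ n, AddCommGroup (FA n)] [∀ n, Module ℝ (FA n)] [∀ n, AddCommGroup (F3 n)] [∀ n, Module ℝ (F3 n)]

/-- **JOIN CERTIFICATE — the (190)-socket `Data190 d M N Wn q` of the (D4) remainder chain IS INHABITED by the per-torus
Sect. G letters (§3: `dHn := dH`, `h190 := h190_of_sectG …` at the record's `q.Cst`, `q.δ15`, row-sum constant `q.cR`
and B-cutting bound `q.κB`) together with the (4.4)-dictionary letters the socket carries verbatim** (the blocks `blk n X̄`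
meeting a localization domain, the identification `ι n X̄` dominated by the local sizes `hdom`, the unit source fields
`u n x` of B-size ≤ m `hm`, localised with conversion factor θ `hD` — [I] p. 282 ↔ [15] read through
`B12Decay510FromB11`).  Nothing of Bałaban's is constructed: once NODE O supplies the operators and the dictionary data
AS TERMS, the socket's NODE-D fields are filled by §3 with no further estimate (remaining inputs: the located leaves of
[15] Sect. G and the numerics `q`).  The inhabitant is the anonymous constructor in the proof; no `def` is introduced.
[cite: Balaban1985Variational, (190) p.308; Balaban1987RG1, (4.4) p.281 and p.282; Balaban1984PropagatorsII, (2.61) p.234] -/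
theorem nonempty_data190_of_sectG (bB : (n : ℕ) → BlockNorm (gn n) (FB n)) (bN : (n : ℕ) → BlockNorm (gn n) (FA n))
    (b3 : (n : ℕ) → BlockNorm (gn n) (F3 n)) (bout : (n : ℕ) → I → BlockNorm (gn n) (FA n))
    (Gt : (n : ℕ) → F3 n →ₗ[ℝ] FA n) (W : (n : ℕ) → FA n →ₗ[ℝ] F3 n) (D2H0 : (n : ℕ) → FB n →ₗ[ℝ] F3 n)
    (H0 H A0 dH : (n : ℕ) → FB n →ₗ[ℝ] FA n) (Dfr : (n : ℕ) → FA n →ₗ[ℝ] FB n) (M₀ : ℕ → ℝ)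
    (blk : (n : ℕ) → TDom d (N n) → Finset (gn n).Site) (ι : (n : ℕ) → TDom d (N n) → FA n → Wn n)
    (u : (n : ℕ) → TPt d (N n * M) → FB n)
    {δ₀ BG BG₂ θW cΔ A₀ A₀₂ AH₂ θD κN κ₃ : ℝ}
    (htri : ∀ n, Triangle254 (gn n)) (hd : ∀ n (a b : (gn n).Site), 0 ≤ (gn n).dist a b) (hδ₀ : 0 ≤ δ₀)
    (hrow : ∀ n, RowSum (gn n) q.σ q.cR) (hσ : q.σ ≤ δ₀ / 8)
    (hBG : 0 ≤ BG) (hBG₂ : 0 ≤ BG₂) (hθW : 0 ≤ θW) (hcΔ : 0 ≤ cΔ) (hA₀ : 0 ≤ A₀) (hA₀₂ : 0 ≤ A₀₂)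
    (hAH₂ : 0 ≤ AH₂) (hθD : 0 ≤ θD) (hM₀ : ∀ n, 0 ≤ M₀ n)
    (hκB : ∀ n, (bB n).κ ≤ q.κB) (hκN : ∀ n, (bN n).κ ≤ κN) (hκ₃ : ∀ n, (b3 n).κ ≤ κ₃)
    (hG : ∀ n, HasMaj (b3 n) (bN n) (Gt n) (fun y y' => BG * Real.exp (-(δ₀ * (gn n).dist y y'))))
    (hG₂ : ∀ n i, HasMaj (b3 n) (bout n i) (Gt n) (fun y y' => BG₂ * Real.exp (-(δ₀ * (gn n).dist y y'))))
    (h189 : ∀ n, Ineq189 (bN n) (b3 n) (W n) θW δ₀)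
    (hD2H0 : ∀ n, HasMaj (bB n) (b3 n) (D2H0 n) (fun y y' => cΔ * Real.exp (-(δ₀ * (gn n).dist y y'))))
    (hH0 : ∀ n, HasMaj (bB n) (bN n) (H0 n) (fun y y' => A₀ * Real.exp (-(δ₀ * (gn n).dist y y'))))
    (hH0₂ : ∀ n i, HasMaj (bB n) (bout n i) (H0 n) (fun y y' => A₀₂ * Real.exp (-(δ₀ * (gn n).dist y y'))))
    (hH₂ : ∀ n i, HasMaj (bB n) (bout n i) (H n) (fun y y' => AH₂ * Real.exp (-(δ₀ / 2 * (gn n).dist y y'))))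
    (hDfr : ∀ n, HasMaj (bN n) (bB n) (Dfr n) (fun y y' => θD * Real.exp (-(δ₀ / 2 * (gn n).dist y y'))))
    (h184 : ∀ n, Eq184 (A0 n) (H0 n) (Gt n) (W n) (D2H0 n)) (h188 : ∀ n, Bound188 (bB n) (bN n) (A0 n) (M₀ n))
    (h182 : ∀ n, Eq182 (dH n) (A0 n) (H0 n) (H n) (Dfr n))
    (hq : qG κ₃ κN BG θW q.cR < 1)
    (hCst : (κ₃ * BG₂ * (cΔ + κN * θW * (A₀ + constA0 κ₃ κN BG θW cΔ A₀ q.cR) * q.cR) * q.cR + A₀₂) +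
        q.κB * AH₂ * (κN * θD * (constA0 κ₃ κN BG θW cΔ A₀ q.cR + A₀) * q.cR) * q.cR ≤ q.Cst)
    (hδ15 : q.δ15 ≤ δ₀)
    (hdom : ∀ n, NormDominated (S := tsys d (N n)) (bout n) (blk n) (V := fun _ => Wn n) (ι n))
    (hm : ∀ n x y', (bB n).loc y' (u n x) ≤ q.m)
    (hD : ∀ n, UnitFieldsLocalised (bB n) (geomT d (N n) M) (blk n) (u n) q.θ) :
    Nonempty (Data190 d M N Wn q) :=
  ⟨{ I := I, gn := gn, FBn := FB, FAn := FA, bBn := bB, boutn := bout, dHn := dH, blkn := blk, ιn := ι, un := u,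
     h190 := h190_of_sectG bB bN b3 bout Gt W D2H0 H0 H A0 dH Dfr M₀ htri hd hδ₀ hrow hσ hBG hBG₂ hθW hcΔ hA₀ hA₀₂
       hAH₂ hθD hM₀ hκB hκN hκ₃ hG hG₂ h189 hD2H0 hH0 hH0₂ hH₂ hDfr h184 h188 h182 hq hCst hδ15,
     hdist := hd, hrow := hrow, hκB := hκB, hdom := hdom, hm := hm, hD := hD }⟩

end Certificate

/-! ## 6. JOIN CERTIFICATE FOR THE ACTUAL DERIVATIVE: Bałaban's (179)–(180) scheme data per torus inhabit `Data190` -/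

section CertificateActual

open B11Eq174Chart B11Eq183Differentiation B11Ineq190Actual
open Literature.MathematicalPhysics.QuantumFieldTheory.Balaban1983to89.B12Decay510FromB11 (NormDominated UnitFieldsLocalised)
open Literature.MathematicalPhysics.QuantumFieldTheory.Balaban1983to89.TreeLengthTorus (TPt TDom tsys)
open Literature.MathematicalPhysics.QuantumFieldTheory.Balaban1983to89.B12Decay510Torus (geomT)
open Literature.MathematicalPhysics.QuantumFieldTheory.Balaban1983to89.Beta.RemainderDecay190 (Data190 Consts190)
variable {d M : ℕ} [NeZero M] {N : ℕ → ℕ} [∀ n, NeZero (N n)] {Wn : ℕ → Type} [∀ n, NormedAddCommGroup (Wn n)]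
  {q : Consts190} {I : Type} {gn : ℕ → B6.Geometry} {𝒳 𝒴 𝒵 : ℕ → Type} [∀ n, NormedAddCommGroup (𝒳 n)]
  [∀ n, NormedSpace ℂ (𝒳 n)] [∀ n, NormedAddCommGroup (𝒴 n)] [∀ n, NormedSpace ℂ (𝒴 n)]
  [∀ n, NormedAddCommGroup (𝒵 n)] [∀ n, NormedSpace ℂ (𝒵 n)] [∀ n, CompleteSpace (𝒳 n)] [∀ n, CompleteSpace (𝒴 n)]
  [∀ n, CompleteSpace (𝒵 n)]

/-- **JOIN CERTIFICATE, ACTUAL DERIVATIVE** — §4 + §5: with Bałaban's (179)–(180) data per torus in the scheme vocabulary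
(`𝒢, Wv, D2, H₀, H, Dm, 𝔇`, regimes, domain points `B n`), the located letters of [15] Sect. G with common O(1) letters,
and the (4.4)-dictionary letters, the (190)-socket `Data190 d M N Wn q` IS INHABITED with `FBn := 𝒳`, `FAn := 𝒴` and
`dHn n := (fderiv ℂ (chartH179 …) (B n)).restrictScalars ℝ` — the first B-derivative of the chart 𝓗(B) ITSELF, no carrier
identity among the hypotheses.  Nothing of Bałaban's is constructed (the data are parameters; instance count unchanged).
[cite: Balaban1985Variational, (179)-(190) pp.306-308, Prop. 9 p.309; Balaban1987RG1, (4.4) p.281 and p.282] -/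
theorem nonempty_data190_of_sectG_actual (𝒢 : (n : ℕ) → 𝒵 n →L[ℂ] 𝒴 n) (Wv : (n : ℕ) → 𝒴 n → 𝒵 n)
    (D2 : (n : ℕ) → 𝒴 n →L[ℂ] 𝒵 n) (H₀ H : (n : ℕ) → 𝒳 n →L[ℂ] 𝒴 n) (Dm : (n : ℕ) → 𝒴 n → 𝒳 n)
    (𝔇 : (n : ℕ) → 𝒴 n →L[ℂ] 𝒳 n) (B₀ θ C₄ a₃ j a ε₄ : ℕ → ℝ) (B : (n : ℕ) → 𝒳 n)
    (R : ∀ n, Regime (𝒢 n) 0 (Wv n) (B₀ n) (θ n) (C₄ n) (a₃ n) (j n) (a n) (ε₄ n))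
    (hWa : ∀ n, AnalyticOnNhd ℂ (Wv n) {Y : 𝒴 n | ‖Y‖ < a₃ n})
    (hJ : ∀ n, ‖D2 n (H₀ n (B n))‖ < j n) (h𝔄 : ∀ n, ‖H₀ n (B n)‖ < a n)
    (hD : ∀ n, HasFDerivAt (Dm n) (𝔇 n) (solA180 (𝒢 n) (Wv n) (D2 n) (H₀ n) (ε₄ n) (B n) + H₀ n (B n)))
    (bB : (n : ℕ) → BlockNorm (gn n) (𝒳 n)) (bN : (n : ℕ) → BlockNorm (gn n) (𝒴 n))
    (b3 : (n : ℕ) → BlockNorm (gn n) (𝒵 n)) (bout : (n : ℕ) → I → BlockNorm (gn n) (𝒴 n))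
    (hN : ∀ n (y : (gn n).Site) (v : 𝒴 n), (bN n).loc y v ≤ ‖v‖)
    (hBloc : ∀ n (y' : (gn n).Site) (μ : 𝒳 n), (bB n).IsLoc y' μ → ‖μ‖ ≤ (bB n).loc y' μ)
    (blk : (n : ℕ) → TDom d (N n) → Finset (gn n).Site) (ι : (n : ℕ) → TDom d (N n) → 𝒴 n → Wn n)
    (u : (n : ℕ) → TPt d (N n * M) → 𝒳 n)
    {δ₀ BG BG₂ θW cΔ A₀ A₀₂ AH₂ θD κN κ₃ : ℝ}
    (htri : ∀ n, Triangle254 (gn n)) (hd : ∀ n (a b : (gn n).Site), 0 ≤ (gn n).dist a b) (hδ₀ : 0 ≤ δ₀)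
    (hrow : ∀ n, RowSum (gn n) q.σ q.cR) (hσ : q.σ ≤ δ₀ / 8)
    (hBG : 0 ≤ BG) (hBG₂ : 0 ≤ BG₂) (hθW : 0 ≤ θW) (hcΔ : 0 ≤ cΔ) (hA₀ : 0 ≤ A₀) (hA₀₂ : 0 ≤ A₀₂)
    (hAH₂ : 0 ≤ AH₂) (hθD : 0 ≤ θD)
    (hκB : ∀ n, (bB n).κ ≤ q.κB) (hκN : ∀ n, (bN n).κ ≤ κN) (hκ₃ : ∀ n, (b3 n).κ ≤ κ₃)
    (hG : ∀ n, HasMaj (b3 n) (bN n) ((𝒢 n).restrictScalars ℝ : 𝒵 n →ₗ[ℝ] 𝒴 n)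
      (fun y y' => BG * Real.exp (-(δ₀ * (gn n).dist y y'))))
    (hG₂ : ∀ n i, HasMaj (b3 n) (bout n i) ((𝒢 n).restrictScalars ℝ : 𝒵 n →ₗ[ℝ] 𝒴 n)
      (fun y y' => BG₂ * Real.exp (-(δ₀ * (gn n).dist y y'))))
    (h189 : ∀ n, Ineq189 (bN n) (b3 n)
      ((fderiv ℂ (Wv n) (solA180 (𝒢 n) (Wv n) (D2 n) (H₀ n) (ε₄ n) (B n) + H₀ n (B n))).restrictScalars ℝ :
        𝒴 n →ₗ[ℝ] 𝒵 n) θW δ₀)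
    (hD2H0 : ∀ n, HasMaj (bB n) (b3 n) ((D2 n ∘L H₀ n).restrictScalars ℝ : 𝒳 n →ₗ[ℝ] 𝒵 n)
      (fun y y' => cΔ * Real.exp (-(δ₀ * (gn n).dist y y'))))
    (hH0 : ∀ n, HasMaj (bB n) (bN n) ((H₀ n).restrictScalars ℝ : 𝒳 n →ₗ[ℝ] 𝒴 n)
      (fun y y' => A₀ * Real.exp (-(δ₀ * (gn n).dist y y'))))
    (hH0₂ : ∀ n i, HasMaj (bB n) (bout n i) ((H₀ n).restrictScalars ℝ : 𝒳 n →ₗ[ℝ] 𝒴 n)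
      (fun y y' => A₀₂ * Real.exp (-(δ₀ * (gn n).dist y y'))))
    (hH₂ : ∀ n i, HasMaj (bB n) (bout n i) ((H n).restrictScalars ℝ : 𝒳 n →ₗ[ℝ] 𝒴 n)
      (fun y y' => AH₂ * Real.exp (-(δ₀ / 2 * (gn n).dist y y'))))
    (hDfr : ∀ n, HasMaj (bN n) (bB n) ((𝔇 n).restrictScalars ℝ : 𝒴 n →ₗ[ℝ] 𝒳 n)
      (fun y y' => θD * Real.exp (-(δ₀ / 2 * (gn n).dist y y'))))
    (hq : qG κ₃ κN BG θW q.cR < 1)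
    (hCst : (κ₃ * BG₂ * (cΔ + κN * θW * (A₀ + constA0 κ₃ κN BG θW cΔ A₀ q.cR) * q.cR) * q.cR + A₀₂) +
        q.κB * AH₂ * (κN * θD * (constA0 κ₃ κN BG θW cΔ A₀ q.cR + A₀) * q.cR) * q.cR ≤ q.Cst)
    (hδ15 : q.δ15 ≤ δ₀)
    (hdom : ∀ n, NormDominated (S := tsys d (N n)) (bout n) (blk n) (V := fun _ => Wn n) (ι n))
    (hm : ∀ n x y', (bB n).loc y' (u n x) ≤ q.m)
    (hD' : ∀ n, UnitFieldsLocalised (bB n) (geomT d (N n) M) (blk n) (u n) q.θ) :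
    Nonempty (Data190 d M N Wn q) :=
  ⟨{ I := I, gn := gn, FBn := 𝒳, FAn := 𝒴, bBn := bB, boutn := bout,
     dHn := fun n => ((fderiv ℂ (chartH179 (𝒢 n) (Wv n) (D2 n) (H₀ n) (fun Y : 𝒴 n => Y - H n (Dm n Y)) (ε₄ n))
       (B n)).restrictScalars ℝ : 𝒳 n →ₗ[ℝ] 𝒴 n),
     blkn := blk, ιn := ι, un := u,
     h190 := h190_of_sectG_actual 𝒢 Wv D2 H₀ H Dm 𝔇 B₀ θ C₄ a₃ j a ε₄ B R hWa hJ h𝔄 hD bB bN b3 bout hN hBloc htri hd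
       hδ₀ hrow hσ hBG hBG₂ hθW hcΔ hA₀ hA₀₂ hAH₂ hθD hκB hκN hκ₃ hG hG₂ h189 hD2H0 hH0 hH0₂ hH₂ hDfr hq hCst hδ15,
     hdist := hd, hrow := hrow, hκB := hκB, hdom := hdom, hm := hm, hD := hD' }⟩

end CertificateActual

end Literature.MathematicalPhysics.QuantumFieldTheory.Balaban1983to89.Beta.RemainderDecay190SectG
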